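import Summits.ResolutionOfSingularities.ResolutionOfSingularities.Theses.HomologicalConductor
import Summits.ResolutionOfSingularities.ResolutionOfSingularities.Theorems.NoZeno.Negative.SurfaceKernelSandwichOrDefect
import Summits.ResolutionOfSingularities.ResolutionOfSingularities.Theorems.NoZeno.Negative.SurfaceKernelNoRegularStage

/-!
# Crux `NoZeno` (stmt-ResolutionOfSingularities-16483) — triage of crux-idea
# `sandwich-subgraph-descent`: a sandwiched-descent function kills the surface kernel modulo LU

Route `ResolutionOfSingularities/HomologicalConductor`, crux
`Summit.ResolutionOfSingularities.ResolutionOfSingularities.Theses.HomologicalConductor.NoZeno`,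
line `birth` (skeleton v7). Negative lane (`--supports` the crux item): structure lemmas, no Theses
decl asserted; OURS (res-L0-w44-tri-1, BARRIER & DEFECT triage of the crux-idea cards of
res-L0-w44-idea-2).

The card `sandwich-subgraph-descent` proposes an `ℕ`-valued function `ρ` of the stage (number of
exceptional curves of the minimal resolution of a sandwiched, hence rational, stage) dropping
strictly at every singular stage that dominates a regular finitely generated model along `O`.
Rendered def-free for the valuation ring at hand (hypothesis `hρ`):

* `surfaceKernel_false_of_descent_of_isLocallyUniformizable`: such a `ρ` plus local
  uniformization of `O` refutes every surface kernel datum (`hker`, `tr.deg 2`) — capture of the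
  uniformizing model (`exh_le_tower_of_fg`, exhaustion by `surfaceKernel_exhausts`), all stages
  singular (`surfaceKernel_not_isRegularLocalRing_tower`), infinite descent.
* `surfaceKernel_defect_of_descent`: over a PERFECT field the Abhyankar habitat needs no input
  (`isLocallyUniformizable_of_transcendenceDefect_eq_zero`), so such a `ρ` confines the surface
  kernel to the DEFECT habitat (`ratRank 1`, transcendence defect `1`).

Triage verdict encoded: the card is unconditional on the irrational/Abhyankar habitat and
SURVIVES-MODULO local uniformization exactly on the defect habitat (and over imperfect `k`).
Kernel-only (axioms `propext`, `Classical.choice`, `Quot.sound`); no `def`, no named fact.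
-/

set_option linter.dupNamespace false

noncomputable section

namespace Summit.ResolutionOfSingularities.ResolutionOfSingularities.Theorems.NoZeno.Negative

open Summit.ResolutionOfSingularities.ResolutionOfSingularities.Theorems
open Summit.ResolutionOfSingularities.ResolutionOfSingularities.Theorems.NoZeno.Birth
open Literature.AlgebraicGeometry.Resolution

variable {k K : Type} [Field k] [Field K] [Algebra k K]

/-- **A SANDWICHED-DESCENT FUNCTION KILLS THE SURFACE KERNEL, MODULO LOCAL UNIFORMIZATION OF `O`**
(triage of crux-idea `sandwich-subgraph-descent`, res-L0-w44-idea-2; def-free rendering of its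
`SandwichedDescent` for the valuation ring at hand: `ρ : Subalgebra k K → ℕ` drops strictly at
every SINGULAR stage that dominates the local ring `loc O R` of a finitely generated model
`R ⊆ O`, `Frac R = K`, regular at the centre). If `O` is locally uniformizable over `k`, no surface
kernel datum (`hker`, `tr.deg 2`) exists: the uniformizing model is captured by a late stage
(`exh_le_tower_of_fg` + `surfaceKernel_exhausts`), every stage is singular
(`surfaceKernel_not_isRegularLocalRing_tower`), and `ρ` would descend for ever. So the card's
residual input on the kernel is exactly LU of `O` — unconditional in the Abhyankar habitat over a
perfect field (next theorem), i.e. carried by the DEFECT habitat and by imperfect `k`. [folklore] -/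
theorem surfaceKernel_false_of_descent_of_isLocallyUniformizable (O : ValuationSubring K)
    (A : Subalgebra k K) (hk : ∀ c : k, algebraMap k K c ∈ O) (hA : A.FG)
    (hfr : IsFractionRing ↥A K) (hAO : A.toSubring ≤ O.toSubring)
    (hker : ∀ O' : ValuationSubring K,
      (∀ m : ℕ, ∀ s ∈ tower O A m, s ∈ O' ∧ (s⁻¹ ∈ O' → s⁻¹ ∈ O)) → ¬ IsNoetherianRing ↥O')
    (htr : Algebra.trdeg k K = 2) (ρ : Subalgebra k K → ℕ)
    (hρ : ∀ m : ℕ, (∃ R : Subalgebra k K, R.FG ∧ R.toSubring ≤ O.toSubring ∧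
        IsFractionRing ↥R K ∧ loc O R ≤ tower O A m ∧ IsRegularLocalRing ↥(loc O R)) →
      ¬ IsRegularLocalRing ↥(tower O A m) → ρ (tower O A (m + 1)) < ρ (tower O A m))
    (hLU : IsLocallyUniformizable k K O) : False := by
  obtain ⟨R, hRO, hRfg, hRfr, hreg⟩ := hLU
  have hexh := surfaceKernel_exhausts O A hk hA hfr hAO hker htr.le
  obtain ⟨m₀, hm₀⟩ := exh_le_tower_of_fg O A hk hAO hexh R hRfg hRO
  have hlocreg : IsRegularLocalRing ↥(loc O R) := by
    rw [loc_eq_locAt]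
    exact (SyzygyFlattening.isRegularLocalRing_locAt_iff_atPrime O R hRO).mpr hreg
  have hdrop : ∀ j : ℕ, ρ (tower O A (m₀ + j + 1)) < ρ (tower O A (m₀ + j)) := fun j =>
    hρ (m₀ + j) ⟨R, hRfg, hRO, hRfr, (hm₀ (m₀ + j) (Nat.le_add_right m₀ j)).2, hlocreg⟩
      (surfaceKernel_not_isRegularLocalRing_tower O A hk hA hfr hAO hker htr.le (m₀ + j))
  have key : ∀ j : ℕ, ρ (tower O A (m₀ + j)) + j ≤ ρ (tower O A (m₀ + 0)) := by
    intro j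
    induction j with
    | zero => simp
    | succ j ih =>
      have h := hdrop j
      rw [show m₀ + (j + 1) = m₀ + j + 1 from rfl]
      omega
  have h := key (ρ (tower O A (m₀ + 0)) + 1)
  omega

/-- **Over a PERFECT field a sandwiched-descent function confines the surface kernel to the DEFECT
habitat** (`ratRank O = 1`, transcendence defect `1`): in the Abhyankar habitat (defect `0`) `O` is
locally uniformizable with no input (Knaf–Kuhlmann for Abhyankar places, tree
`isLocallyUniformizable_of_transcendenceDefect_eq_zero`), so the previous theorem applies; the
habitat alternative is `surfaceKernel_habitat_of_hker`. Triage reading: crux-idea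
`sandwich-subgraph-descent` is UNCONDITIONAL on the irrational/Abhyankar habitat and
SURVIVES-MODULO local uniformization exactly on the defect habitat (and over imperfect `k`).
[folklore] -/
theorem surfaceKernel_defect_of_descent [PerfectField k] (O : ValuationSubring K)
    (A : Subalgebra k K) (hk : ∀ c : k, algebraMap k K c ∈ O) (hA : A.FG)
    (hfr : IsFractionRing ↥A K) (hAO : A.toSubring ≤ O.toSubring)
    (hker : ∀ O' : ValuationSubring K,
      (∀ m : ℕ, ∀ s ∈ tower O A m, s ∈ O' ∧ (s⁻¹ ∈ O' → s⁻¹ ∈ O)) → ¬ IsNoetherianRing ↥O')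
    (htr : Algebra.trdeg k K = 2) (ρ : Subalgebra k K → ℕ)
    (hρ : ∀ m : ℕ, (∃ R : Subalgebra k K, R.FG ∧ R.toSubring ≤ O.toSubring ∧
        IsFractionRing ↥R K ∧ loc O R ≤ tower O A m ∧ IsRegularLocalRing ↥(loc O R)) →
      ¬ IsRegularLocalRing ↥(tower O A m) → ρ (tower O A (m + 1)) < ρ (tower O A m)) :
    ratRank O = 1 ∧ transcendenceDefect k O hk = 1 := by
  rcases (surfaceKernel_habitat_of_hker O A hk hA hfr hAO hker htr).2 with ⟨-, hD, -⟩ | h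
  · haveI := hfr
    haveI : Algebra.FiniteType k ↥A := A.fg_iff_finiteType.mp hA
    have hfg : (⊤ : IntermediateField k K).FG :=
      IntermediateField.fg_top_of_isFractionRing_of_finiteType k ↥A K
    exact (surfaceKernel_false_of_descent_of_isLocallyUniformizable O A hk hA hfr hAO hker htr ρ
      hρ (isLocallyUniformizable_of_transcendenceDefect_eq_zero hfg O hk hD)).elim
  · exact h

end Summit.ResolutionOfSingularities.ResolutionOfSingularities.Theorems.NoZeno.Negative

end
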